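import Literature.NumberTheory.EllipticCurves.UnramifiedPointLiftProofs
import Literature.NumberTheory.EllipticCurves.SpectralValuationUnramified
import Literature.NumberTheory.EllipticCurves.FormalGroupChartLevel
import HarnessLib

/-!
# Points of `E₁` over an unramified layer `K_v(ζ)`: the levels of the formal filtration have
# successive indices at most `qⁿ`, and exactly `qⁿ` well-separated points

`Proofs` file (theorems only, no definitions, no named facts) in topic
`NumberTheory/EllipticCurves`; first local step of the proof of the named fact
`Literature.NumberTheory.EllipticCurves.integral_neronScaling_of_isGloballyMinimal`
(`NeronIsogenyScaling.lean`; integrality of the multiplier of a `ℚ`-isogeny between globally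
minimal models) by COUNTING points over the finite unramified layers `K_n = K_v(ζ)` (`ζ` a
primitive `(qⁿ - 1)`-th root of unity, `q = #k_v`) of `K̄_v` — see the module docstring of
`NeronIsogenyScalingProofs.lean` for the architecture. The classical input formalised here is the
structure of the filtration `E₁(K_n) ⊇ E₁(K_n)⁽¹⁾ ⊇ E₁(K_n)⁽²⁾ ⊇ ⋯` by the local parameter
`z = -x/y` (Silverman, *AEC*, IV.3.2(a): `Ê(𝓜ʲ)/Ê(𝓜ʲ⁺¹) ≅ 𝓜ʲ/𝓜ʲ⁺¹`; Prop. VII.2.2: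
`E₁(K) ≅ Ê(𝓜)`; here `𝓜ʲ/𝓜ʲ⁺¹ ≅ 𝔽_{qⁿ}` for the unramified layer), in the language of the tree:
`FormalGroupChart.kernel w V` (`E₁`), `FormalGroupChart.level w V t` (`{|z| ≤ t}`), the layer
points `(Point.map (val K_n)).range`, the spectral valuation `w = |·|_v` on `K̄_v`, a uniformiser
`ϖ` of `𝓞_v` (`ρ = |ϖ|_v`), a residue map `r : 𝒪_w → k̄_v` and an arithmetic Frobenius `F`
(hypotheses `hw, h𝔐, hF, hr, hrF` as in `UnramifiedLayerResidueProofs`). For the base change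
`V = X ⊗ K̄_v` of a Weierstrass equation `X/K_v` with `w`-integral coefficients:

* `zCoord_mem_adjoin_of_mem_range` — layer points have `z(P) ∈ K_n`;
* `val_zCoord_le_of_mem_range` — **`E₁(K_n) = E⁽ρ⁾ ∩ E(K_n)`**: `|z(P)|_v ≤ ρ` on `E₁(K_n)` (the
  value group of the unramified layer is that of `K_v`, `spectralValuation_le_uniformizer_of_mem_adjoin`);
* `sub_mem_level_succ_iff_residue_eq` — for layer points `P, Q` of level `j`
  (`|z| ≤ ρʲ`), **`P - Q` has level `j + 1` iff `z(P)/ϖʲ ≡ z(Q)/ϖʲ (mod 𝔪)`**;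
* `residue_zCoord_div_mem` — the residue of `z(P)/ϖʲ` lies in `𝔽_{qⁿ} = {0} ∪ μ_{qⁿ-1}(k̄_v)`;
* `relIndex_level_succ_inf_range_le` — **`[E⁽ρʲ⁾(K_n) : E⁽ρʲ⁺¹⁾(K_n)] ≤ qⁿ`**, and the index is
  finite (`≠ 0`), for `j ≥ 1`: `P ↦ z(P)/ϖʲ mod 𝔪` is a homomorphism into `𝔽_{qⁿ}`
  (first-order additivity `val_zCoord_add_sub_le`) with kernel the next level;
* `exists_mem_kernel_mem_range_zCoord_eq_mul` and `not_sub_mem_level_succ_of_ne` — conversely,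
  for `X` elliptic and `j ≥ 1`, every `z = ϖʲt` with `t ∈ {0} ∪ μ_{qⁿ-1}` is `z(P_t)` for a layer
  point `P_t` of level `j` (`exists_mem_kernel_mem_range_zCoord_eq`, Hensel in the layer), and
  `P_t - P_{t'}` is NOT of level `j + 1` for `t ≠ t'` (distinct Teichmüller representatives are
  incongruent): **`qⁿ` points of level `j` pairwise inequivalent modulo level `j + 1`**.

## References

* [SilvermanAEC2009] J. H. Silverman, *The Arithmetic of Elliptic Curves*, 2nd ed., GTM 106
  (2009): Prop. IV.3.2(a), Prop. VII.2.2, IV.6 / VII.3 (the filtration of `E₁`).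
* [SerreLocalFields1979] J.-P. Serre, *Local Fields*, GTM 67 (1979): II §4 Prop. 8
  (multiplicative representatives), IV §4 Prop. 16.

## Design

Theorems only (D-0026); setting, notation and hypotheses verbatim those of
`UnramifiedLayerResidueProofs` / `UnramifiedHenselLiftProofs`; one universe `u`.
-/

noncomputable section

open scoped Classical NNReal Pointwise
open NumberField IsDedekindDomain Polynomial

universe u

namespace IsDedekindDomain.HeightOneSpectrum

open Literature.NumberTheory.EllipticCurves Literature.NumberTheory.GaloisRepresentations Field
  Literature.NumberTheory.EllipticCurves.FormalGroupChart

variable {K : Type u} [Field K] [NumberField K] {v : HeightOneSpectrum (𝓞 K)}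
  {w : Valuation (AlgebraicClosure (v.adicCompletion K)) ℝ≥0}
  (hw : ∀ x, (w x : ℝ) = spectralNorm (v.adicCompletion K) (AlgebraicClosure (v.adicCompletion K)) x)
  {𝔐 : Ideal v.localAbsIntegers} (h𝔐 : 𝔐 ∈ v.localPrimesAbove)
  {F : absoluteGaloisGroup (v.adicCompletion K)}
  (hF : IsArithFrobAt (v.adicCompletionIntegers K) F 𝔐)
  {r : w.integer →+* AlgebraicClosure (IsLocalRing.ResidueField (v.adicCompletionIntegers K))}
  (hr : ∀ a : w.integer, r a = 0 ↔ w (a : AlgebraicClosure (v.adicCompletion K)) < 1)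
  (hrF : ∀ (z : w.integer) (h : w (F • (z : AlgebraicClosure (v.adicCompletion K))) ≤ 1),
    r ⟨F • (z : AlgebraicClosure (v.adicCompletion K)), h⟩ =
      r z ^ Nat.card (IsLocalRing.ResidueField (v.adicCompletionIntegers K)))
  {ϖ : v.adicCompletionIntegers K} (hϖ : Irreducible ϖ)
  {n : ℕ} (hn : n ≠ 0) {ζ : AlgebraicClosure (v.adicCompletion K)}
  (hζ : IsPrimitiveRoot ζ (Nat.card (IsLocalRing.ResidueField (v.adicCompletionIntegers K)) ^ n - 1))
  (X : WeierstrassCurve (v.adicCompletion K))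
  [hV : (X.baseChange (AlgebraicClosure (v.adicCompletion K))).IsIntegral w.integer]

/-! ## Layer points: `z(P) ∈ K_n` and `|z(P)|_v ≤ ρ` on `E₁(K_n)` -/

omit hV in
/-- A point with coordinates in the layer `K_n = K_v(ζ)` has its local parameter `z = -x/y`
in `K_n`. [folklore] -/
theorem zCoord_mem_adjoin_of_mem_range
    {P : (X.baseChange (AlgebraicClosure (v.adicCompletion K))).toAffine.Point}
    (hP : P ∈ (WeierstrassCurve.Affine.Point.map (W' := X)
      (IntermediateField.val (IntermediateField.adjoin (v.adicCompletion K) {ζ}))).range) :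
    P.zCoord ∈ IntermediateField.adjoin (v.adicCompletion K) {ζ} := by
  obtain ⟨P₀, rfl⟩ := hP
  rcases P₀ with _ | ⟨x, y, hxy⟩
  · rw [← WeierstrassCurve.Affine.Point.zero_def, map_zero, WeierstrassCurve.Affine.Point.zCoord_zero]
    exact zero_mem _
  · rw [WeierstrassCurve.Affine.Point.map_some, WeierstrassCurve.Affine.Point.zCoord_some]
    exact div_mem (neg_mem x.2) y.2

include hw h𝔐 hϖ hn hζ in
omit hV in
/-- **`|z(P)|_v ≤ ρ = |ϖ|_v` for `P ∈ E₁` with coordinates in the unramified layer `K_n`**: the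
value group of `K_n` is that of `K_v` (`spectralValuation_le_uniformizer_of_mem_adjoin`) and
`|z(P)|_v < 1` on `E₁`. Equivalently `E₁(K_n) ⊆ E⁽ρ⁾`. [cite: SilvermanAEC2009, Prop. VII.2.2] -/
theorem val_zCoord_le_of_mem_range
    [hV : (X.baseChange (AlgebraicClosure (v.adicCompletion K))).IsIntegral w.integer]
    {P : (X.baseChange (AlgebraicClosure (v.adicCompletion K))).toAffine.Point}
    (hP1 : P ∈ kernel w (X.baseChange (AlgebraicClosure (v.adicCompletion K))))
    (hP : P ∈ (WeierstrassCurve.Affine.Point.map (W' := X)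
      (IntermediateField.val (IntermediateField.adjoin (v.adicCompletion K) {ζ}))).range) :
    w P.zCoord ≤ w (algebraMap (v.adicCompletion K) (AlgebraicClosure (v.adicCompletion K))
      (ϖ : v.adicCompletion K)) :=
  spectralValuation_le_uniformizer_of_mem_adjoin hw h𝔐 (residueCard_pow_sub_one_ne_zero (v := v) hn)
    (spectralValuation_natCast_residueCard_pow_sub_one hw hn) hζ.pow_eq_one hϖ
    (zCoord_mem_adjoin_of_mem_range X hP) (val_zCoord_lt_one hP1)

/-! ## Levels: `P - Q ∈ E⁽ρʲ⁺¹⁾ ↔ z(P)/ϖʲ ≡ z(Q)/ϖʲ (mod 𝔪)` -/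

include hw hϖ in
omit hV in
/-- `|z/ϖʲ|_v ≤ 1` when `|z|_v ≤ ρʲ` (`ρ = |ϖ|_v > 0`). [folklore] -/
theorem spectralValuation_div_uniformizer_pow_le_one {z : AlgebraicClosure (v.adicCompletion K)}
    {j : ℕ} (hz : w z ≤ w (algebraMap (v.adicCompletion K) (AlgebraicClosure (v.adicCompletion K))
      (ϖ : v.adicCompletion K)) ^ j) :
    w (z / algebraMap (v.adicCompletion K) (AlgebraicClosure (v.adicCompletion K))
      (ϖ : v.adicCompletion K) ^ j) ≤ 1 := by
  have hρ := spectralValuation_uniformizer_pos_lt_one hw hϖ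
  rw [map_div₀, map_pow]
  exact div_le_one_of_le₀ hz zero_le

include hw h𝔐 hr hϖ hn hζ in
/-- **The level criterion on the unramified layer.** For `P, Q ∈ E₁` with coordinates in `K_n`
and `|z(P)|_v, |z(Q)|_v ≤ ρʲ`: `P - Q ∈ E⁽ρʲ⁺¹⁾` iff `z(P)/ϖʲ` and `z(Q)/ϖʲ` have the same
residue. Indeed `|z(P - Q)| = |z(P) - z(Q)|` (`sub_mem_level_iff`), residues agree iff
`|z(P) - z(Q)| < ρʲ` (`residue_eq_residue_iff`), and for the element `(z(P) - z(Q))/ϖʲ` of the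
unramified layer `< 1` means `≤ ρ` (`spectralValuation_le_uniformizer_of_mem_adjoin`). This is
`Ê(𝓜ʲ)/Ê(𝓜ʲ⁺¹) ↪ 𝓜ʲ/𝓜ʲ⁺¹` (Silverman, *AEC*, Prop. IV.3.2(a)) for the layer.
[cite: SilvermanAEC2009, Prop. IV.3.2(a) with Prop. VII.2.2] -/
theorem sub_mem_level_succ_iff_residue_eq {j : ℕ}
    {P Q : (X.baseChange (AlgebraicClosure (v.adicCompletion K))).toAffine.Point}
    (hP1 : P ∈ kernel w (X.baseChange (AlgebraicClosure (v.adicCompletion K))))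
    (hQ1 : Q ∈ kernel w (X.baseChange (AlgebraicClosure (v.adicCompletion K))))
    (hP : P ∈ (WeierstrassCurve.Affine.Point.map (W' := X)
      (IntermediateField.val (IntermediateField.adjoin (v.adicCompletion K) {ζ}))).range)
    (hQ : Q ∈ (WeierstrassCurve.Affine.Point.map (W' := X)
      (IntermediateField.val (IntermediateField.adjoin (v.adicCompletion K) {ζ}))).range)
    (hPj : w P.zCoord ≤ w (algebraMap (v.adicCompletion K) (AlgebraicClosure (v.adicCompletion K))
      (ϖ : v.adicCompletion K)) ^ j)
    (hQj : w Q.zCoord ≤ w (algebraMap (v.adicCompletion K) (AlgebraicClosure (v.adicCompletion K))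
      (ϖ : v.adicCompletion K)) ^ j) :
    P - Q ∈ level w (X.baseChange (AlgebraicClosure (v.adicCompletion K)))
        (w (algebraMap (v.adicCompletion K) (AlgebraicClosure (v.adicCompletion K))
          (ϖ : v.adicCompletion K)) ^ (j + 1)) ↔
      r ⟨P.zCoord / algebraMap (v.adicCompletion K) (AlgebraicClosure (v.adicCompletion K))
          (ϖ : v.adicCompletion K) ^ j, spectralValuation_div_uniformizer_pow_le_one hw hϖ hPj⟩ =
        r ⟨Q.zCoord / algebraMap (v.adicCompletion K) (AlgebraicClosure (v.adicCompletion K))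
          (ϖ : v.adicCompletion K) ^ j, spectralValuation_div_uniformizer_pow_le_one hw hϖ hQj⟩ := by
  -- notation
  set π : AlgebraicClosure (v.adicCompletion K) :=
    algebraMap (v.adicCompletion K) (AlgebraicClosure (v.adicCompletion K)) (ϖ : v.adicCompletion K)
    with hπ
  obtain ⟨hρ0, hρ1⟩ := spectralValuation_uniformizer_pos_lt_one hw hϖ
  have hπj0 : w (π ^ j) ≠ 0 := by rw [map_pow]; exact pow_ne_zero _ hρ0.ne'
  have hm0 := residueCard_pow_sub_one_ne_zero (v := v) hn
  have hm1 := spectralValuation_natCast_residueCard_pow_sub_one hw hn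
  rw [sub_mem_level_iff hP1 hQ1, residue_eq_residue_iff hr]
  change w (P.zCoord - Q.zCoord) ≤ w π ^ (j + 1) ↔ w (P.zCoord / π ^ j - Q.zCoord / π ^ j) < 1
  have hd : P.zCoord / π ^ j - Q.zCoord / π ^ j = (P.zCoord - Q.zCoord) / π ^ j := by
    rw [sub_div]
  have hwd : w ((P.zCoord - Q.zCoord) / π ^ j) = w (P.zCoord - Q.zCoord) / w π ^ j := by
    rw [map_div₀, map_pow]
  rw [hd]
  constructor
  · intro h
    rw [hwd, div_lt_one (by rw [← map_pow]; exact lt_of_le_of_ne zero_le hπj0.symm)]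
    calc w (P.zCoord - Q.zCoord) ≤ w π ^ (j + 1) := h
      _ < w π ^ j := by rw [pow_succ]; exact mul_lt_of_lt_one_right (pow_pos hρ0 j) hρ1
  · intro h
    -- the quotient lies in the layer, so `< 1` forces `≤ ρ`
    have hmem : (P.zCoord - Q.zCoord) / π ^ j ∈
        IntermediateField.adjoin (v.adicCompletion K) {ζ} :=
      div_mem (sub_mem (zCoord_mem_adjoin_of_mem_range X hP) (zCoord_mem_adjoin_of_mem_range X hQ))
        (pow_mem (IntermediateField.algebraMap_mem _ _) j)
    have hle : w ((P.zCoord - Q.zCoord) / π ^ j) ≤ w π :=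
      spectralValuation_le_uniformizer_of_mem_adjoin hw h𝔐 hm0 hm1 hζ.pow_eq_one hϖ hmem h
    rw [hwd, div_le_iff₀ (by rw [← map_pow]; exact lt_of_le_of_ne zero_le hπj0.symm)] at hle
    rwa [pow_succ, mul_comm]

include hw h𝔐 hF hr hrF hϖ hn hζ in
omit hV in
/-- **Residues of `z(P)/ϖʲ` for layer points lie in `𝔽_{qⁿ} = {0} ∪ μ_{qⁿ-1}(k̄_v)`**
(`residue_pow_card_pow_eq_of_mem_adjoin`: residues of integral elements of `K_n` satisfy
`x̄^{qⁿ} = x̄`; `mem_insert_zero_image_pow_of_pow_eq` with the primitive root `r(ζ)`,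
`isPrimitiveRoot_residue`). [cite: SerreLocalFields1979, Ch. II §4 Prop. 8] -/
theorem residue_div_uniformizer_pow_mem {z : AlgebraicClosure (v.adicCompletion K)} {j : ℕ}
    (hzK : z ∈ IntermediateField.adjoin (v.adicCompletion K) {ζ})
    (hz : w z ≤ w (algebraMap (v.adicCompletion K) (AlgebraicClosure (v.adicCompletion K))
      (ϖ : v.adicCompletion K)) ^ j) :
    r ⟨z / algebraMap (v.adicCompletion K) (AlgebraicClosure (v.adicCompletion K))
        (ϖ : v.adicCompletion K) ^ j, spectralValuation_div_uniformizer_pow_le_one hw hϖ hz⟩ ∈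
      insert (0 : AlgebraicClosure (IsLocalRing.ResidueField (v.adicCompletionIntegers K)))
        ((Finset.range (Nat.card (IsLocalRing.ResidueField (v.adicCompletionIntegers K)) ^ n - 1)).image
          (fun i : ℕ ↦ r ⟨ζ, spectralValuation_le_one_of_isPrimitiveRoot hn hζ⟩ ^ i)) := by
  have hm0 := residueCard_pow_sub_one_ne_zero (v := v) hn
  have hprim := isPrimitiveRoot_residue hw hr hn hζ (spectralValuation_le_one_of_isPrimitiveRoot hn hζ)
  have hmem : z / algebraMap (v.adicCompletion K) (AlgebraicClosure (v.adicCompletion K))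
      (ϖ : v.adicCompletion K) ^ j ∈ IntermediateField.adjoin (v.adicCompletion K) {ζ} :=
    div_mem hzK (pow_mem (IntermediateField.algebraMap_mem _ _) j)
  have hpow := residue_pow_card_pow_eq_of_mem_adjoin hw h𝔐 hF hrF hn hζ hmem
    (spectralValuation_div_uniformizer_pow_le_one hw hϖ hz)
  refine mem_insert_zero_image_pow_of_pow_eq hprim hm0 ?_
  rwa [Nat.sub_add_cancel (Nat.one_le_pow n _ Nat.card_pos)]

/-! ## `[E⁽ρʲ⁾(K_n) : E⁽ρʲ⁺¹⁾(K_n)] ≤ qⁿ` for `j ≥ 1` -/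

include hw h𝔐 hF hr hrF hϖ hn hζ in
/-- **The successive indices of the formal filtration of `E₁(K_n)` are at most `qⁿ`, and finite.**
For `j ≥ 1` the subgroup `E⁽ρʲ⁺¹⁾ ∩ E(K_n)` has index at most `qⁿ` (and `≠ 0`, i.e. finite index)
in `E⁽ρʲ⁾ ∩ E(K_n)`: the map `P ↦ z(P)/ϖʲ mod 𝔪` is a homomorphism into `k̄_v` (first-order
additivity `|z(P + Q) - z(P) - z(Q)| ≤ max(|z(P)|, |z(Q)|)² ≤ ρ²ʲ < ρʲ`,
`val_zCoord_add_sub_le`), its kernel is `E⁽ρʲ⁺¹⁾ ∩ E(K_n)`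
(`sub_mem_level_succ_iff_residue_eq`) and its image lies in the `qⁿ`-element set
`{0} ∪ μ_{qⁿ-1}(k̄_v)` (`residue_div_uniformizer_pow_mem`). Silverman, *AEC*, Prop. IV.3.2(a)
(`Ê(𝓜ʲ)/Ê(𝓜ʲ⁺¹) ≅ 𝓜ʲ/𝓜ʲ⁺¹`, here `≅ 𝔽_{qⁿ}`) with Prop. VII.2.2.
[cite: SilvermanAEC2009, Prop. IV.3.2(a) with Prop. VII.2.2] -/
theorem relIndex_level_succ_inf_range_le {j : ℕ} (hj : 1 ≤ j) :
    (level w (X.baseChange (AlgebraicClosure (v.adicCompletion K)))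
          (w (algebraMap (v.adicCompletion K) (AlgebraicClosure (v.adicCompletion K))
            (ϖ : v.adicCompletion K)) ^ (j + 1)) ⊓
        (WeierstrassCurve.Affine.Point.map (W' := X)
          (IntermediateField.val (IntermediateField.adjoin (v.adicCompletion K) {ζ}))).range).relIndex
      (level w (X.baseChange (AlgebraicClosure (v.adicCompletion K)))
          (w (algebraMap (v.adicCompletion K) (AlgebraicClosure (v.adicCompletion K))
            (ϖ : v.adicCompletion K)) ^ j) ⊓
        (WeierstrassCurve.Affine.Point.map (W' := X)
          (IntermediateField.val (IntermediateField.adjoin (v.adicCompletion K) {ζ}))).range) ≤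
      Nat.card (IsLocalRing.ResidueField (v.adicCompletionIntegers K)) ^ n ∧
    (level w (X.baseChange (AlgebraicClosure (v.adicCompletion K)))
          (w (algebraMap (v.adicCompletion K) (AlgebraicClosure (v.adicCompletion K))
            (ϖ : v.adicCompletion K)) ^ (j + 1)) ⊓
        (WeierstrassCurve.Affine.Point.map (W' := X)
          (IntermediateField.val (IntermediateField.adjoin (v.adicCompletion K) {ζ}))).range).relIndex
      (level w (X.baseChange (AlgebraicClosure (v.adicCompletion K)))
          (w (algebraMap (v.adicCompletion K) (AlgebraicClosure (v.adicCompletion K))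
            (ϖ : v.adicCompletion K)) ^ j) ⊓
        (WeierstrassCurve.Affine.Point.map (W' := X)
          (IntermediateField.val (IntermediateField.adjoin (v.adicCompletion K) {ζ}))).range) ≠ 0 := by
  -- notation: `π = ϖ` in `K̄_v`, `Rg` the layer points, `G ⊇ H` the two levels
  set π : AlgebraicClosure (v.adicCompletion K) :=
    algebraMap (v.adicCompletion K) (AlgebraicClosure (v.adicCompletion K)) (ϖ : v.adicCompletion K)
    with hπ
  set Rg : AddSubgroup (X.baseChange (AlgebraicClosure (v.adicCompletion K))).toAffine.Point :=
    (WeierstrassCurve.Affine.Point.map (W' := X)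
      (IntermediateField.val (IntermediateField.adjoin (v.adicCompletion K) {ζ}))).range with hRg
  set G : AddSubgroup (X.baseChange (AlgebraicClosure (v.adicCompletion K))).toAffine.Point :=
    level w (X.baseChange (AlgebraicClosure (v.adicCompletion K))) (w π ^ j) ⊓ Rg with hG
  set H : AddSubgroup (X.baseChange (AlgebraicClosure (v.adicCompletion K))).toAffine.Point :=
    level w (X.baseChange (AlgebraicClosure (v.adicCompletion K))) (w π ^ (j + 1)) ⊓ Rg with hH
  obtain ⟨hρ0, hρ1⟩ := spectralValuation_uniformizer_pos_lt_one hw hϖ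
  have hm0 := residueCard_pow_sub_one_ne_zero (v := v) hn
  have h1 : w ζ ≤ 1 := spectralValuation_le_one_of_isPrimitiveRoot hn hζ
  have hprim := isPrimitiveRoot_residue hw hr hn hζ h1
  have hπj : 0 < w π ^ j := pow_pos hρ0 j
  -- points of `G`: in `E₁`, in the layer, of level `j`
  have hG1 : ∀ P : G, (P : (X.baseChange (AlgebraicClosure (v.adicCompletion K))).toAffine.Point) ∈
      kernel w (X.baseChange (AlgebraicClosure (v.adicCompletion K))) := fun P ↦ P.2.1.1
  have hGj : ∀ P : G, w (P : (X.baseChange (AlgebraicClosure (v.adicCompletion K))).toAffine.Point).zCoord ≤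
      w π ^ j := fun P ↦ P.2.1.2
  have hGR : ∀ P : G, (P : (X.baseChange (AlgebraicClosure (v.adicCompletion K))).toAffine.Point) ∈ Rg :=
    fun P ↦ P.2.2
  -- the homomorphism `ψ : G → k̄_v`, `P ↦ z(P)/ϖʲ mod 𝔪`
  have hint : ∀ P : G,
      w ((P : (X.baseChange (AlgebraicClosure (v.adicCompletion K))).toAffine.Point).zCoord / π ^ j) ≤ 1 :=
    fun P ↦ spectralValuation_div_uniformizer_pow_le_one hw hϖ (hGj P)
  let ψf : G → AlgebraicClosure (IsLocalRing.ResidueField (v.adicCompletionIntegers K)) :=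
    fun P ↦ r ⟨(P : (X.baseChange (AlgebraicClosure (v.adicCompletion K))).toAffine.Point).zCoord / π ^ j,
      hint P⟩
  have hψf : ∀ P : G, ψf P =
      r ⟨(P : (X.baseChange (AlgebraicClosure (v.adicCompletion K))).toAffine.Point).zCoord / π ^ j,
        hint P⟩ := fun _ ↦ rfl
  have hψ0 : ψf 0 = 0 := by
    rw [hψf, ← map_zero r]
    congr 1
    apply Subtype.ext
    change ((0 : G) : (X.baseChange (AlgebraicClosure (v.adicCompletion K))).toAffine.Point).zCoord / π ^ j = 0
    rw [ZeroMemClass.coe_zero, WeierstrassCurve.Affine.Point.zCoord_zero, zero_div]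
  -- first-order additivity: the defect `(z(P + Q) - z(P) - z(Q))/ϖʲ` has valuation `< 1`
  have hdef : ∀ P Q : G,
      w ((((P : (X.baseChange (AlgebraicClosure (v.adicCompletion K))).toAffine.Point) + Q).zCoord -
        (P : (X.baseChange (AlgebraicClosure (v.adicCompletion K))).toAffine.Point).zCoord -
        (Q : (X.baseChange (AlgebraicClosure (v.adicCompletion K))).toAffine.Point).zCoord) / π ^ j) < 1 := by
    intro P Q
    rw [map_div₀, map_pow, div_lt_one hπj]
    refine (val_zCoord_add_sub_le (hG1 P) (hG1 Q)).trans_lt ?_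
    calc max (w (P : (X.baseChange (AlgebraicClosure (v.adicCompletion K))).toAffine.Point).zCoord)
          (w (Q : (X.baseChange (AlgebraicClosure (v.adicCompletion K))).toAffine.Point).zCoord) ^ 2
        ≤ (w π ^ j) ^ 2 := by gcongr; exact max_le (hGj P) (hGj Q)
      _ < w π ^ j := by
        rw [sq]
        refine mul_lt_of_lt_one_left hπj (pow_lt_one₀ zero_le hρ1 ?_)
        omega
  have hψadd : ∀ P Q : G, ψf (P + Q) = ψf P + ψf Q := by
    intro P Q
    -- the three integral elements and their alternating sum
    set a : w.integer := ⟨((P + Q : G) : (X.baseChange (AlgebraicClosure (v.adicCompletion K))).toAffine.Point).zCoord /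
      π ^ j, hint (P + Q)⟩ with ha
    set b : w.integer := ⟨(P : (X.baseChange (AlgebraicClosure (v.adicCompletion K))).toAffine.Point).zCoord /
      π ^ j, hint P⟩ with hb
    set c : w.integer := ⟨(Q : (X.baseChange (AlgebraicClosure (v.adicCompletion K))).toAffine.Point).zCoord /
      π ^ j, hint Q⟩ with hc
    have hval : ((a - b - c : w.integer) : AlgebraicClosure (v.adicCompletion K)) =
        (((P : (X.baseChange (AlgebraicClosure (v.adicCompletion K))).toAffine.Point) + Q).zCoord -
          (P : (X.baseChange (AlgebraicClosure (v.adicCompletion K))).toAffine.Point).zCoord -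
          (Q : (X.baseChange (AlgebraicClosure (v.adicCompletion K))).toAffine.Point).zCoord) / π ^ j := by
      rw [AddSubgroupClass.coe_sub, AddSubgroupClass.coe_sub, ha, hb, hc]
      change ((P + Q : G) : (X.baseChange (AlgebraicClosure (v.adicCompletion K))).toAffine.Point).zCoord /
          π ^ j - (P : (X.baseChange (AlgebraicClosure (v.adicCompletion K))).toAffine.Point).zCoord / π ^ j -
        (Q : (X.baseChange (AlgebraicClosure (v.adicCompletion K))).toAffine.Point).zCoord / π ^ j = _
      rw [sub_div, sub_div]
      rfl
    have hr0 : r (a - b - c) = 0 := (hr _).mpr (by rw [hval]; exact hdef P Q)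
    rw [map_sub, map_sub, sub_sub, sub_eq_zero] at hr0
    rw [hψf, hψf, hψf]
    exact hr0
  let ψ : G →+ AlgebraicClosure (IsLocalRing.ResidueField (v.adicCompletionIntegers K)) :=
    { toFun := ψf, map_zero' := hψ0, map_add' := hψadd }
  have hψ : ∀ P : G, ψ P = ψf P := fun _ ↦ rfl
  -- its kernel is `H`
  have hker : ψ.ker = H.addSubgroupOf G := by
    ext P
    rw [AddMonoidHom.mem_ker, AddSubgroup.mem_addSubgroupOf, hψ]
    have h0 : ((0 : G) : (X.baseChange (AlgebraicClosure (v.adicCompletion K))).toAffine.Point) ∈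
        kernel w (X.baseChange (AlgebraicClosure (v.adicCompletion K))) := hG1 0
    have key := sub_mem_level_succ_iff_residue_eq hw h𝔐 hr hϖ hn hζ X (j := j) (hG1 P) h0 (hGR P) (hGR 0)
      (hGj P) (hGj 0)
    have e : (P : (X.baseChange (AlgebraicClosure (v.adicCompletion K))).toAffine.Point) -
        ((0 : G) : (X.baseChange (AlgebraicClosure (v.adicCompletion K))).toAffine.Point) = P := by
      rw [ZeroMemClass.coe_zero, sub_zero]
    rw [e] at key
    rw [← hψ0, hψf, hψf, ← key, hH, AddSubgroup.mem_inf]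
    exact ⟨fun h ↦ ⟨h, hGR P⟩, fun h ↦ h.1⟩
  -- its image lies in the `qⁿ`-element set `{0} ∪ μ_{qⁿ-1}`
  set S : Finset (AlgebraicClosure (IsLocalRing.ResidueField (v.adicCompletionIntegers K))) :=
    insert 0 ((Finset.range (Nat.card (IsLocalRing.ResidueField (v.adicCompletionIntegers K)) ^ n - 1)).image
      (fun i : ℕ ↦ r ⟨ζ, h1⟩ ^ i)) with hS
  have hScard : S.card = Nat.card (IsLocalRing.ResidueField (v.adicCompletionIntegers K)) ^ n := by
    rw [hS, card_insert_zero_image_pow hprim hm0, Nat.sub_add_cancel (Nat.one_le_pow n _ Nat.card_pos)]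
  have hrange : (ψ.range : Set (AlgebraicClosure (IsLocalRing.ResidueField (v.adicCompletionIntegers K)))) ⊆
      (↑S : Set (AlgebraicClosure (IsLocalRing.ResidueField (v.adicCompletionIntegers K)))) := by
    rintro _ ⟨P, rfl⟩
    rw [hψ, hψf]
    exact residue_div_uniformizer_pow_mem hw h𝔐 hF hr hrF hϖ hn hζ
      (zCoord_mem_adjoin_of_mem_range X (hGR P)) (hGj P)
  have hfin : (↑S : Set (AlgebraicClosure (IsLocalRing.ResidueField (v.adicCompletionIntegers K)))).Finite :=
    S.finite_toSet
  have hidx : H.relIndex G = Nat.card ψ.range := by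
    rw [AddSubgroup.relIndex, ← hker, AddSubgroup.index_ker]
  constructor
  · rw [hidx, ← hScard, ← Nat.card_eq_finsetCard]
    exact Nat.card_mono hfin hrange
  · rw [hidx]
    haveI : Finite ψ.range := Set.Finite.to_subtype (hfin.subset hrange)
    exact Nat.card_ne_zero.mpr ⟨⟨0, ψ.range.zero_mem⟩, inferInstance⟩

/-! ## Conversely: `qⁿ` points of level `j` pairwise inequivalent modulo level `j + 1` -/

include hw hn hζ in
omit hV in
/-- **Distinct Teichmüller representatives are incongruent**: for `t ≠ t'` in
`{0} ∪ μ_{qⁿ-1}(K̄_v)` one has `|t - t'|_v ≥ 1` (reduction is injective on the roots of unity of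
order prime to `p`, `eq_of_pow_eq_one_of_val_sub_lt_one`; and `|ζⁱ|_v = 1`). Serre, *Local
Fields*, II §4 Prop. 8. [cite: SerreLocalFields1979, Ch. II §4 Prop. 8] -/
theorem one_le_spectralValuation_sub_of_ne {t t' : AlgebraicClosure (v.adicCompletion K)}
    (ht : t ∈ insert (0 : AlgebraicClosure (v.adicCompletion K))
      ((Finset.range (Nat.card (IsLocalRing.ResidueField (v.adicCompletionIntegers K)) ^ n - 1)).image
        (fun i : ℕ ↦ ζ ^ i)))
    (ht' : t' ∈ insert (0 : AlgebraicClosure (v.adicCompletion K))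
      ((Finset.range (Nat.card (IsLocalRing.ResidueField (v.adicCompletionIntegers K)) ^ n - 1)).image
        (fun i : ℕ ↦ ζ ^ i)))
    (hne : t ≠ t') : 1 ≤ w (t - t') := by
  have hm0 := residueCard_pow_sub_one_ne_zero (v := v) hn
  have hm1 := spectralValuation_natCast_residueCard_pow_sub_one hw hn
  -- roots of unity in the set have `t^m = 1` and `|t| = 1`
  have hroot : ∀ {s : AlgebraicClosure (v.adicCompletion K)}, s ∈
      ((Finset.range (Nat.card (IsLocalRing.ResidueField (v.adicCompletionIntegers K)) ^ n - 1)).image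
        (fun i : ℕ ↦ ζ ^ i)) →
      s ^ (Nat.card (IsLocalRing.ResidueField (v.adicCompletionIntegers K)) ^ n - 1) = 1 := by
    intro s hs
    obtain ⟨i, -, rfl⟩ := Finset.mem_image.mp hs
    rw [← pow_mul, mul_comm, pow_mul, hζ.pow_eq_one, one_pow]
  by_contra hlt
  push Not at hlt
  rcases Finset.mem_insert.mp ht with rfl | ht
  · rcases Finset.mem_insert.mp ht' with rfl | ht'
    · exact hne rfl
    · rw [zero_sub, Valuation.map_neg, val_eq_one_of_pow_eq_one w hm0 (hroot ht')] at hlt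
      exact lt_irrefl _ hlt
  · rcases Finset.mem_insert.mp ht' with rfl | ht'
    · rw [sub_zero, val_eq_one_of_pow_eq_one w hm0 (hroot ht)] at hlt
      exact lt_irrefl _ hlt
    · exact hne (eq_of_pow_eq_one_of_val_sub_lt_one w hm0 hm1 (hroot ht) (hroot ht') hlt)

include hw hϖ hn hζ in
/-- **Points of level `j` with prescribed leading digit are inequivalent modulo level `j + 1`.**
If `P, P' ∈ E₁` have `z(P) = ϖʲt`, `z(P') = ϖʲt'` with `t ≠ t'` in `{0} ∪ μ_{qⁿ-1}`, then
`P - P' ∉ E⁽ρʲ⁺¹⁾`: `|z(P - P')| = |z(P) - z(P')| = ρʲ|t - t'| = ρʲ > ρʲ⁺¹`. Silverman, *AEC*,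
Prop. IV.3.2(a) with Prop. VII.2.2 (the injection `Ê(𝓜ʲ)/Ê(𝓜ʲ⁺¹) ↪ 𝓜ʲ/𝓜ʲ⁺¹` is onto the
Teichmüller digits). [cite: SilvermanAEC2009, Prop. IV.3.2(a) with Prop. VII.2.2] -/
theorem not_sub_mem_level_succ_of_ne {j : ℕ} {t t' : AlgebraicClosure (v.adicCompletion K)}
    (ht : t ∈ insert (0 : AlgebraicClosure (v.adicCompletion K))
      ((Finset.range (Nat.card (IsLocalRing.ResidueField (v.adicCompletionIntegers K)) ^ n - 1)).image
        (fun i : ℕ ↦ ζ ^ i)))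
    (ht' : t' ∈ insert (0 : AlgebraicClosure (v.adicCompletion K))
      ((Finset.range (Nat.card (IsLocalRing.ResidueField (v.adicCompletionIntegers K)) ^ n - 1)).image
        (fun i : ℕ ↦ ζ ^ i)))
    (hne : t ≠ t')
    {P P' : (X.baseChange (AlgebraicClosure (v.adicCompletion K))).toAffine.Point}
    (hP1 : P ∈ kernel w (X.baseChange (AlgebraicClosure (v.adicCompletion K))))
    (hP'1 : P' ∈ kernel w (X.baseChange (AlgebraicClosure (v.adicCompletion K))))
    (hzP : P.zCoord = algebraMap (v.adicCompletion K) (AlgebraicClosure (v.adicCompletion K))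
      (ϖ : v.adicCompletion K) ^ j * t)
    (hzP' : P'.zCoord = algebraMap (v.adicCompletion K) (AlgebraicClosure (v.adicCompletion K))
      (ϖ : v.adicCompletion K) ^ j * t') :
    P - P' ∉ level w (X.baseChange (AlgebraicClosure (v.adicCompletion K)))
      (w (algebraMap (v.adicCompletion K) (AlgebraicClosure (v.adicCompletion K))
        (ϖ : v.adicCompletion K)) ^ (j + 1)) := by
  obtain ⟨hρ0, hρ1⟩ := spectralValuation_uniformizer_pos_lt_one hw hϖ
  rw [sub_mem_level_iff hP1 hP'1, hzP, hzP', ← mul_sub, map_mul, map_pow, not_le]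
  have h1 := one_le_spectralValuation_sub_of_ne hw hn hζ ht ht' hne
  calc w (algebraMap (v.adicCompletion K) (AlgebraicClosure (v.adicCompletion K))
        (ϖ : v.adicCompletion K)) ^ (j + 1)
      < w (algebraMap (v.adicCompletion K) (AlgebraicClosure (v.adicCompletion K))
        (ϖ : v.adicCompletion K)) ^ j := by
        rw [pow_succ]; exact mul_lt_of_lt_one_right (pow_pos hρ0 j) hρ1
    _ ≤ w (algebraMap (v.adicCompletion K) (AlgebraicClosure (v.adicCompletion K))
        (ϖ : v.adicCompletion K)) ^ j * w (t - t') := le_mul_of_one_le_right zero_le h1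

include hw hϖ in
/-- **Every Teichmüller digit occurs at every level `j ≥ 1` on `E₁(K_n)`** (`X` elliptic): for
`t ∈ K_n` with `|t|_v ≤ 1` there is a layer point `P ∈ E₁` with `z(P) = ϖʲt` (so `|z(P)| ≤ ρʲ`)
— Hensel's lemma in the layer, `exists_mem_kernel_mem_range_zCoord_eq`. Silverman, *AEC*,
Prop. VII.2.2 (the parameter `z` maps `E₁(K)` onto `𝓜` over a complete field).
[cite: SilvermanAEC2009, Prop. VII.2.2] -/
theorem exists_mem_kernel_mem_range_zCoord_eq_mul [X.IsElliptic] {m : ℕ} (hm0 : m ≠ 0) (hζm : ζ ^ m = 1)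
    {j : ℕ} (hj : 1 ≤ j) {t : AlgebraicClosure (v.adicCompletion K)}
    (htK : t ∈ IntermediateField.adjoin (v.adicCompletion K) {ζ}) (ht1 : w t ≤ 1) :
    ∃ P : (X.baseChange (AlgebraicClosure (v.adicCompletion K))).toAffine.Point,
      P ∈ kernel w (X.baseChange (AlgebraicClosure (v.adicCompletion K))) ∧
      P ∈ (WeierstrassCurve.Affine.Point.map (W' := X)
        (IntermediateField.val (IntermediateField.adjoin (v.adicCompletion K) {ζ}))).range ∧
      P.zCoord = algebraMap (v.adicCompletion K) (AlgebraicClosure (v.adicCompletion K))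
        (ϖ : v.adicCompletion K) ^ j * t ∧
      w P.zCoord ≤ w (algebraMap (v.adicCompletion K) (AlgebraicClosure (v.adicCompletion K))
        (ϖ : v.adicCompletion K)) ^ j := by
  obtain ⟨hρ0, hρ1⟩ := spectralValuation_uniformizer_pos_lt_one hw hϖ
  set π : AlgebraicClosure (v.adicCompletion K) :=
    algebraMap (v.adicCompletion K) (AlgebraicClosure (v.adicCompletion K)) (ϖ : v.adicCompletion K)
    with hπ
  have hmem : π ^ j * t ∈ IntermediateField.adjoin (v.adicCompletion K) {ζ} :=
    mul_mem (pow_mem (IntermediateField.algebraMap_mem _ _) j) htK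
  have hle : w (π ^ j * t) ≤ w π ^ j := by
    rw [map_mul, map_pow]; exact mul_le_of_le_one_right zero_le ht1
  have hlt : w (π ^ j * t) < 1 :=
    hle.trans_lt (pow_lt_one₀ zero_le hρ1 (by omega))
  obtain ⟨P, hP1, hPR, hPz⟩ := exists_mem_kernel_mem_range_zCoord_eq hw X hm0 hζm ⟨π ^ j * t, hmem⟩ hlt
  exact ⟨P, hP1, hPR, hPz, by rw [hPz]; exact hle⟩

end IsDedekindDomain.HeightOneSpectrum

end
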